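import Literature.MathematicalPhysics.QuantumFieldTheory.Balaban1983to89.T3OneStepAveragingPlaquettes
import Literature.MathematicalPhysics.QuantumFieldTheory.Balaban1983to89.T3PrintedMinimiserExistence
import Literature.MathematicalPhysics.QuantumFieldTheory.Balaban1983to89.B11Thm1LevelZero
import HarnessLib

/-!
# `Balaban1983to89.T3AvgDivergenceSplit` — rung R3, crux K1, child «MinimiserStabilityRegPr» (stmt-QuantumFields-19200), stub LOWER: the located
# gap G-K1a-3a (`AvgDivSmallAt`, the covariant-DIVERGENCE clause [Balaban1985RegularSpaces] (1.9) of the one-step (0.4)-average of print's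
# minimiser) SPLIT into [Balaban1985Variational] Thm 1 (9)–(10) (PRINTED, read gauge-invariantly at the top scale) ∧ a first-order regularity
# statement about the (0.4) AVERAGING ALONE (located gap G-K1a-3a′, no variational problem in it), the composition PROVED; and the exact size of
# the gap measured by the crude route (PROVED: plaquette-smallness alone reaches the divergence radius `604·B₃ε₁·L^{K−n}`, one power of
# `η⁻¹ = L^{K−n}` short)

Cell `ym3-torus` (HUMAN RULING D-0037, YM ladder rung R3), seat `ym3-torus-p1` gen 7 (UV side); cell record HOME/UV3-NODE.md §16.  WHAT THIS IS
NOT: no proof of the stub and no estimate on minimisers — the two analytic inputs below are HYPOTHESIS SCHEMAS (never asserted); what is PROVED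
is (§1) the crude kinematics of the divergence clause on the torus (from the cell's `B11Thm1LevelZero.norm_covDivT_toUField_le`: «each
backward covariant derivative of the plaquette field costs two plaquette deviations»), (§3) the composition of the two schemas into
`T3LowerAlongMinimisersSplit.AvgDivSmallAt` with explicit thresholds, and (§4) the resulting shape of the registered `stub_lower` of the
layer-4 birth of the item (skeleton bae94eb2c92e16a5): LOWER ⇐ [Balaban1985Variational] Prop 8 (PRINTED) ∧ Thm 1 (9)–(10) (PRINTED) ∧
G-K1a-3a′ (located, averaging only) ∧ G-K1a-3b (located, `AvgActionIneqAt`).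

THE POINT.  `AvgDivSmallAt L a₀ a₁ B₃` asks, for a minimiser `U′` of the Wilson action over print's space (6) of run `K+1` lying in (8) (radius
`B₃ε₁`), that its one-step average `Ū′ = D_{K,K+1}U′` satisfy `‖(D^{1*}_{Ū′}∂Ū′)(b)‖ < ε₀·L^{−3(K−n)}` at every bond of run `K`'s finest lattice.
* THE CRUDE ROUTE AND WHY IT FAILS (§1, PROVED).  For ANY `SU(2)` configuration with `|U(∂p) − 1| < δ`: `‖(D^{1*}_U∂U)(b)‖ ≤ 2(d−1)δ = 4δ`
  (`divSmall_of_plaqSmall`: the two-clause space `𝔘_k(ε₀)` CONTAINS the plaquette-only space at threshold `ε₀L^{−3(K−n)}/4`, a sandwich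
  `regFibre(e) ⊆ regFibrePr(ε₀) ⊆ regFibre(ε₀)` for `4e < ε₀L^{−(K−n)}`, `regFibre_subset_regFibrePr`).  Applied to `Ū′`, whose plaquettes are
  `< 151·B₃ε₁·L^{−2(K−n)}` (tree `T3OneStepAveragingPlaquettes.plaqSmall_descendTo_of_mem8'`), it yields the divergence radius
  `604·B₃ε₁·L^{K−n}` (`divSmall_descendTo_crude`) — NOT `ε₀`: the clause (1.9) is a DERIVATIVE condition, one power of `η = L^{−(K−n)}` finer
  than (1.7), and `ε₁ = θBal(⌊K/m⌋) ≈ √γ·L^{−K/(2m)}` does not beat `L^{K−n} = L^{K−⌊K/m⌋}` for any `m ≥ 2`.  So G-K1a-3a needs ONE COVARIANT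
  DERIVATIVE OF THE MINIMISER'S CURVATURE — exactly what [Balaban1985Variational] Thm 1 (9) (`‖A‖_{1,β₀}`, `β₀ = 1`) and (10) print.
* THE SPLIT (§2 schemas, §3 PROVED).  (i) **`MinimiserCurvGradAt L a₀ a₁ B₃ B₄`** = Thm 1 (9)–(10) READ GAUGE-INVARIANTLY AT THE TOP SCALE for
  minimisers over (6): every backward covariant derivative of the plaquette field is `< B₄ε₁·L^{−3(K−n)}` (print: in the local gauge
  `U^{u⁻¹} = e^{iηA}` on cubes, `|∇^ηA| < B₃Mε₁(L^jη)^{−2}`, `‖A‖_{1,1} < B₄(1)Mε₁(L^jη)^{−3}`, `|Δ^ηA| < B₃Mε₁(L^jη)^{−3}`; the covariant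
  derivative of `∂U = e^{iη²(∇A + O(A²))}` is gauge-COVARIANT, so its norm is read in any gauge — PRINTED modulo this reading and the port of
  the averaging, [Balaban1987RG1] p. 253); (ii) **`AvgCurvGradAt L C₁ C₂ c`** = located gap **G-K1a-3a′**: FIRST-ORDER REGULARITY OF THE ONE-STEP
  (0.4)-AVERAGE — if all plaquettes of `U` are within `a ≤ c` of `1` and all covariant derivatives of its plaquette field are `≤ b`, then all
  covariant derivatives of the plaquette field of `D_{K,K+1}U` are `≤ C₁b + C₂a²` (the zeroth-order twin, `|Ū(∂p′) − 1| ≤ 151L²a`, is the TREE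
  theorem `BlockAveragingPlaquetteBound.plaqSmall_blockAvg_expMeanLogSU`; expected constants `C₁ ≍ L³`, `C₂ ≍ L⁴`; a statement about the
  averaging operation only — UNPRINTED; in kind: the linearisation of the average [Balaban1985Averaging] (122)/(134) and the sentence before
  [Balaban1985UV3] (44) p. 267 for the plaquette clause).  (iii) **`avgDivSmallAt_of_split`** (PROVED): (i) ∧ (ii) ∧ the constants relation
  `4C₁B₄ ≤ L³B₃` ⇒ `AvgDivSmallAt L a₀ a₁′ B₃`, `a₁′ = min {a₁, c/B₃, L³/(8C₂B₃)}` (arithmetic: `(d−1)(C₁b + C₂a²) ≤ 2L^{−3}(C₁B₄ε₁ +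
  C₂B₃²ε₁²)·L^{−3(K−n)} ≤ ¾B₃ε₁·L^{−3(K−n)} < ε₀L^{−3(K−n)}`); the relation is a NORMALISATION of print's `B₃` (all three schemas are monotone
  in `B₃`, `minimisersIn8At_mono`/`minimiserCurvGradAt_mono`), removed in **`avgDivSmallAt_of_split_max`** (`B₃′ := max B₃ (4C₁B₄/L³)`).
* §4 **`stub_lower_shape_of_split`**: the BODY of the registered `stub_lower` from [7] Prop 8 ∧ Thm 1 (9)–(10) ∧ G-K1a-3a′ ∧ G-K1a-3b at `B₃′`.

References: T. Bałaban, CMP 102 (1985) 277–309 [Balaban1985Variational] (Thm 1 (8)–(10) p.279, Prop 8 p.304); CMP 99 (1985) 75–102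
[Balaban1985RegularSpaces] ((1.1)–(1.2) p.76, (1.7)–(1.9) p.77); CMP 98 (1985) 17–51 [Balaban1985Averaging] (Prop 1 (51) p.26, (122) p.36, (134)
p.38); CMP 102 (1985) 255–275 [Balaban1985UV3] (p.267, sentence before (44)); CMP 109 (1987) 249–301 [Balaban1987RG1] ((0.4), p.253).
-/

noncomputable section

open MeasureTheory Filter Topology
open scoped Matrix.Norms.L2Operator
open Literature.MathematicalPhysics.QuantumFieldTheory.Balaban1983to89.T3ContinuumYM3Torus
open Literature.MathematicalPhysics.QuantumFieldTheory.Balaban1983to89.T3UnitLawDensityEML (ℰp measurableE_ℰp)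
open Literature.MathematicalPhysics.QuantumFieldTheory.Balaban1983to89.T3UnitScaleTilt
open Literature.MathematicalPhysics.QuantumFieldTheory.Balaban1983to89.T3TiltDescent
open Literature.MathematicalPhysics.QuantumFieldTheory.Balaban1983to89.T3CruxEstimates
open Literature.MathematicalPhysics.QuantumFieldTheory.Balaban1983to89.T3ConstrainedMinimiser
open Literature.MathematicalPhysics.QuantumFieldTheory.Balaban1983to89.T3DescentFibreTower
open Literature.MathematicalPhysics.QuantumFieldTheory.Balaban1983to89.T3RegularMinimiser
open Literature.MathematicalPhysics.QuantumFieldTheory.Balaban1983to89.T3PrintedRegularMinimiser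
open Literature.MathematicalPhysics.QuantumFieldTheory.Balaban1983to89.T3PrintedRegularMinimiserReduction
open Literature.MathematicalPhysics.QuantumFieldTheory.Balaban1983to89.T3PrintedMinimiserExistence
open Literature.MathematicalPhysics.QuantumFieldTheory.Balaban1983to89.T3ThresholdSmallness (exists_forall_θBal_le)
open Literature.MathematicalPhysics.QuantumFieldTheory.Balaban1983to89.T3LowerAlongMinimisersSplit
open Literature.MathematicalPhysics.QuantumFieldTheory.Balaban1983to89.T3OneStepAveragingPlaquettes
open Literature.MathematicalPhysics.QuantumFieldTheory.Balaban1983to89.ExpMeanLog (deltaSU deltaSU_pos)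
open Literature.MathematicalPhysics.QuantumFieldTheory.Balaban1983to89.B10Eq27TorusAxialLog (toUField unitsField)
open Literature.MathematicalPhysics.QuantumFieldTheory.Balaban1983to89.B10Eq68TorusRegularity (plaqFT covDerivT covDivT)
open Literature.MathematicalPhysics.QuantumFieldTheory.Balaban1983to89.B11Thm1LevelZero (norm_covDivT_toUField_le)
open Literature.MathematicalPhysics.QuantumFieldTheory.Balaban1983to89.Missing

namespace Literature.MathematicalPhysics.QuantumFieldTheory.Balaban1983to89.T3AvgDivergenceSplit

/-! ## §1 Crude kinematics of the divergence clause: `‖D^{1*}∂U‖ ≤ 4·max|U(∂p) − 1|`, the sandwich of fibres, and the crude route's reach -/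

section Generic

variable {P : Params} {s : ℕ} {𝔸 : Type*} [NormedRing 𝔸] [NormedAlgebra ℂ 𝔸]

/-- **THE DIVERGENCE FROM THE DERIVATIVES**: if every backward covariant derivative of every (off-diagonal) plaquette field of `V` at `x` is
`≤ B`, then `‖(D^{η*}_V ∂V)_μ(x)‖ ≤ (d − 1)·B` — (1.2) is a signed sum of `d − 1` such derivatives. [cite: Balaban1985RegularSpaces, (1.2) p.76] -/
theorem norm_covDivT_le_of_covDerivT_le {η : ℝ} (V : GaugeField P s 𝔸ˣ) {x : Site P s} {B : ℝ}
    (hB : ∀ (ν κ κ' : Fin P.d), κ ≠ κ' → ‖covDerivT η V ν (plaqFT V κ κ') x‖ ≤ B) (μ : Fin P.d) :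
    ‖covDivT η V μ x‖ ≤ ((P.d - 1 : ℕ) : ℝ) * B := by
  unfold covDivT
  have hIio : ‖∑ ν ∈ Finset.Iio μ, covDerivT η V ν (plaqFT V ν μ) x‖ ≤ (Finset.Iio μ).card • B :=
    (norm_sum_le _ _).trans (Finset.sum_le_card_nsmul _ _ _ fun ν hν => hB ν ν μ (Finset.mem_Iio.mp hν).ne)
  have hIoi : ‖∑ ν ∈ Finset.Ioi μ, covDerivT η V ν (plaqFT V μ ν) x‖ ≤ (Finset.Ioi μ).card • B :=
    (norm_sum_le _ _).trans (Finset.sum_le_card_nsmul _ _ _ fun ν hν => hB ν μ ν (Finset.mem_Ioi.mp hν).ne)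
  have hcard : ((Finset.Iio μ).card : ℝ) + (Finset.Ioi μ).card = ((P.d - 1 : ℕ) : ℝ) := by
    rw [Fin.card_Iio, Fin.card_Ioi]
    have hμ := μ.isLt
    rw [← Nat.cast_add]
    congr 1
    omega
  calc ‖∑ ν ∈ Finset.Iio μ, covDerivT η V ν (plaqFT V ν μ) x - ∑ ν ∈ Finset.Ioi μ, covDerivT η V ν (plaqFT V μ ν) x‖
      ≤ (Finset.Iio μ).card • B + (Finset.Ioi μ).card • B := (norm_sub_le _ _).trans (add_le_add hIio hIoi)
    _ = ((P.d - 1 : ℕ) : ℝ) * B := by rw [nsmul_eq_mul, nsmul_eq_mul, ← add_mul, hcard]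

end Generic

section Crude

variable (F : T3Family)

/-- `d − 1 = 2` for the family (bookkeeping). [cite: Balaban1985UV3, (1)-(3) p.256] -/
private theorem d_sub_one_cast (K : ℕ) : (((F.P K).d - 1 : ℕ) : ℝ) = 2 := by
  rw [T3Family.P_d]; norm_num

/-- **THE DIVERGENCE CLAUSE FROM THE PLAQUETTE CLAUSE, CRUDELY** (d = 3, `SU(2)`): `|U(∂p) − 1| < δ` at every plaquette and
`4δ < ε₀·L^{−3(K−n)}` ⇒ `U` satisfies the divergence clause (1.9) of run `K` over the height `n` with radius `ε₀` (each of the `d − 1 = 2`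
backward covariant derivatives in (1.2) costs two plaquette deviations, `B11Thm1LevelZero.norm_covDivT_toUField_le`).
[cite: Balaban1985RegularSpaces, (1.7)/(1.9) p.77] -/
theorem divSmall_of_plaqSmall {n K : ℕ} {ε₀ δ : ℝ} {U : GaugeField (F.P K) 0 (Matrix.specialUnitaryGroup (Fin 2) ℂ)}
    (hU : PlaqSmall δ U) (h4 : 4 * δ < ε₀ * ((F.L : ℝ)⁻¹) ^ (3 * (K - n))) : DivSmall F n K ε₀ U := by
  intro b
  have h := norm_covDivT_toUField_le U one_pos hU b.dir b.src
  rw [d_sub_one_cast, inv_one, one_mul] at h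
  linarith

/-- **`𝔘_k(ε₀)` IN FULL FROM PLAQUETTE SMALLNESS AT THE FINER THRESHOLD**: `PlaqSmall δ U` with `δ ≤ ε₀L^{−2(K−n)}` and `4δ < ε₀L^{−3(K−n)}` ⇒
`RegPr F n K ε₀ U` (both clauses of [Balaban1985Variational] (2)). [cite: Balaban1985Variational, (2) p.278] -/
theorem regPr_of_plaqSmall {n K : ℕ} {ε₀ δ : ℝ} {U : GaugeField (F.P K) 0 (Matrix.specialUnitaryGroup (Fin 2) ℂ)}
    (hU : PlaqSmall δ U) (hδ : δ ≤ regThreshold F n K ε₀) (h4 : 4 * δ < ε₀ * ((F.L : ℝ)⁻¹) ^ (3 * (K - n))) :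
    RegPr F n K ε₀ U :=
  ⟨plaqSmall_of_le hδ hU, divSmall_of_plaqSmall F hU h4⟩

/-- `ε₀·L^{−3(K−n)} = (ε₀L^{−(K−n)})·L^{−2(K−n)}`: the divergence radius as a plaquette threshold (bookkeeping). [cite: Balaban1985RegularSpaces, (1.9) p.77] -/
theorem divRadius_eq_regThreshold (n K : ℕ) (ε₀ : ℝ) :
    ε₀ * ((F.L : ℝ)⁻¹) ^ (3 * (K - n)) = regThreshold F n K (ε₀ * ((F.L : ℝ)⁻¹) ^ (K - n)) := by
  unfold regThreshold
  rw [mul_assoc, ← pow_add]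
  congr 2
  ring

/-- **THE SANDWICH OF FIBRES** (quantitative form of the setting of the cell gap G-K1aR-1): for `0 ≤ ε₀` and `4e < ε₀·L^{−(K−n)}`, the tree's
plaquette-only regular fibre at radius `e` lies inside PRINT'S two-clause fibre (6) at radius `ε₀` (which lies inside the plaquette-only fibre
at radius `ε₀`, `regFibrePr_subset_regFibre`): `regFibre(e) ⊆ regFibrePr(ε₀) ⊆ regFibre(ε₀)`. [cite: Balaban1985Variational, (2) and (6) p.278] -/
theorem regFibre_subset_regFibrePr {n K : ℕ} {h : n ≤ K} {ε₀ e : ℝ} (hε₀ : 0 ≤ ε₀) (he : 4 * e < ε₀ * ((F.L : ℝ)⁻¹) ^ (K - n))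
    (V : GaugeField (F.P n) 0 (Matrix.specialUnitaryGroup (Fin 2) ℂ)) : regFibre F ℰp n K h e V ⊆ regFibrePr F n K h ε₀ V := by
  intro U hU
  obtain ⟨ht, ht1⟩ := scale_pos_le_one F (K - n)
  obtain ⟨hs, _⟩ := scale_pos_le_one F (2 * (K - n))
  -- `e ≤ ε₀` (from `4e < ε₀η ≤ ε₀`), so the plaquette clause transfers
  have he' : e ≤ ε₀ := by nlinarith [mul_le_of_le_one_right hε₀ ht1]
  refine ⟨⟨hU.1, plaqSmall_of_le (regThreshold_mono F he') hU.2⟩, divSmall_of_plaqSmall F hU.2 ?_⟩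
  -- `4·(eL^{−2(K−n)}) < ε₀L^{−3(K−n)} = (ε₀L^{−(K−n)})·L^{−2(K−n)}`
  rw [divRadius_eq_regThreshold]
  unfold regThreshold
  nlinarith [mul_lt_mul_of_pos_right he hs]

/-- Hence `minActionRegPr(ε₀) ≤ minActionReg(e)` for `4e < ε₀L^{−(K−n)}` whenever the plaquette-only fibre at radius `e` is nonempty (bigger set,
smaller infimum; with `minActionReg(ε₀) ≤ minActionRegPr(ε₀)` of the tree, a sandwich of minima). [cite: Balaban1985Variational, Thm 1 (8) p.279] -/
theorem minActionRegPr_le_minActionReg_of_small {n K : ℕ} {h : n ≤ K} {ε₀ e : ℝ} (hε₀ : 0 ≤ ε₀)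
    (he : 4 * e < ε₀ * ((F.L : ℝ)⁻¹) ^ (K - n)) {V : GaugeField (F.P n) 0 (Matrix.specialUnitaryGroup (Fin 2) ℂ)}
    (hne : (regFibre F ℰp n K h e V).Nonempty) : minActionRegPr F n K h ε₀ V ≤ minActionReg F ℰp n K h e V :=
  le_csInf (hne.image _) (by
    rintro _ ⟨U, hU, rfl⟩
    exact minActionRegPr_le F (regFibre_subset_regFibrePr F hε₀ he V hU))

/-- **THE CRUDE ROUTE'S REACH FOR THE AVERAGED MINIMISER — THE EXACT SIZE OF GAP G-K1a-3a** (PROVED): if `U′ ∈ (8)_{K+1}` (radius `B₃ε₁ > 0`,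
`(25L²/4)B₃ε₁ < δ₂`), then its one-step (0.4)-average satisfies the divergence clause of run `K` with ANY radius `ρ > 604·B₃ε₁·L^{K−n}`
(plaquettes of the average `< 151B₃ε₁L^{−2(K−n)}` by the tree's one-step Prop 1, then §1's factor `4`: `604B₃ε₁L^{−2(K−n)} =
(604B₃ε₁L^{K−n})·L^{−3(K−n)}`).  The needed radius is `ε₀`, FIXED; `L^{K−n} = L^{K−⌊K/m⌋} → ∞`: plaquette smallness alone misses (1.9) for
averages by exactly one power of `η⁻¹` — the located gap is one covariant derivative of the minimiser's curvature, [Balaban1985Variational]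
(9)–(10). [cite: Balaban1985RegularSpaces, (1.7)/(1.9) p.77] -/
theorem divSmall_descendTo_crude {n K : ℕ} (hnK : n ≤ K) {B₃ ε₁ ρ : ℝ} (hBε : 0 < B₃ * ε₁)
    (hδ : (25 * (F.L : ℝ) ^ 2 / 4) * (B₃ * ε₁) < deltaSU (Fin 2)) (hρ : 604 * (B₃ * ε₁) * (F.L : ℝ) ^ (K - n) < ρ)
    {V : GaugeField (F.P n) 0 (Matrix.specialUnitaryGroup (Fin 2) ℂ)} {U' : GaugeField (F.P (K + 1)) 0 (Matrix.specialUnitaryGroup (Fin 2) ℂ)}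
    (hU' : U' ∈ regFibrePr F n (K + 1) (hnK.trans (Nat.le_succ K)) (B₃ * ε₁) V) :
    DivSmall F n K ρ (descendTo F ℰp K (K + 1) (Nat.le_succ K) U') := by
  have hplaq := plaqSmall_descendTo_of_mem8' F hnK hBε le_rfl hδ hU'
  refine divSmall_of_plaqSmall F hplaq ?_
  -- `4·151B₃ε₁·L^{−2(K−n)} = 604B₃ε₁L^{K−n}·L^{−3(K−n)} < ρ·L^{−3(K−n)}`
  have hL : (0 : ℝ) < F.L := L_cast_pos F
  obtain ⟨ht, _⟩ := scale_pos_le_one F (3 * (K - n))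
  have hid : 4 * regThreshold F n K (151 * (B₃ * ε₁)) = (604 * (B₃ * ε₁) * (F.L : ℝ) ^ (K - n)) * ((F.L : ℝ)⁻¹) ^ (3 * (K - n)) := by
    unfold regThreshold
    rw [show 3 * (K - n) = (K - n) + 2 * (K - n) by ring, pow_add, inv_pow, inv_pow]
    field_simp
    ring
  rw [hid]
  exact mul_lt_mul_of_pos_right hρ ht

end Crude

/-! ## §2 The schemas: [Balaban1985Variational] Thm 1 (9)–(10) read gauge-invariantly (PRINTED), first-order regularity of the average (LOCATED) -/

section Schemas

/-- **[Balaban1985Variational] THM 1 (9)–(10) READ GAUGE-INVARIANTLY AT THE TOP SCALE, FOR MINIMISERS OVER (6)** (hypothesis schema, never asserted):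
for `0 < ε₁ ≤ a₁`, `B₃ε₁ ≤ ε₀ ≤ a₀`, `n < K`, a datum `V` satisfying (7), and every minimiser `U` of the Wilson action over print's space (6) =
`regFibrePr F n K _ ε₀ V`: EVERY backward covariant derivative ([Balaban1985RegularSpaces] (1.1)) of every plaquette field of `U` (read in `M₂(ℂ)`
through `SU(2) ≤ U(2)`, operator norm, `η`-free form) is `< B₄ε₁·L^{−3(K−n)}`.  Print: «… on □, U^{u⁻¹} = e^{iηA}, |A| < B₃Mε₁(L^jη)^{−1},
|∇^ηA| < B₃Mε₁(L^jη)^{−2}, ‖A‖_{1,β} < B₄(β₀)Mε₁(L^jη)^{−2−β} for 0 ≤ β ≤ β₀ = 1, (9) |∂^{η*}∂^ηA|, |Δ^ηA| < B₃Mε₁(L^jη)^{−3}. (10)»; at the top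
scale `L^jη = 1`, `M` absorbed, the `β = 1` Hölder clause bounds the second differences of `A` = the first covariant differences of the curvature,
whose norm is gauge-independent ([Balaban1985RegularSpaces] (1.11)) — PRINTED modulo this reading and the port of the averaging (0.4) ([Balaban1987RG1]
p. 253); a minimiser over the open space (6) is critical, hence on Thm 1's unique critical orbit. [cite: Balaban1985Variational, Thm 1 (9)-(10) p.279] -/
def MinimiserCurvGradAt (L : ℕ) (a₀ a₁ B₃ B₄ : ℝ) : Prop :=
  ∀ F : T3Family, F.L = L → ∀ (n K : ℕ) (hnK : n < K) (ε₁ ε₀ : ℝ), 0 < ε₁ → ε₁ ≤ a₁ → B₃ * ε₁ ≤ ε₀ → ε₀ ≤ a₀ →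
    ∀ V : GaugeField (F.P n) 0 (Matrix.specialUnitaryGroup (Fin 2) ℂ), PlaqSmall ε₁ V →
      ∀ U ∈ regFibrePr F n K hnK.le ε₀ V,
        IsMinOn (fun W : GaugeField (F.P K) 0 (Matrix.specialUnitaryGroup (Fin 2) ℂ) => wilsonAction4 W) (regFibrePr F n K hnK.le ε₀ V) U →
          ∀ (x : Site (F.P K) 0) (ν κ κ' : Fin (F.P K).d), κ ≠ κ' →
            ‖covDerivT 1 (unitsField (toUField U)) ν (plaqFT (unitsField (toUField U)) κ κ') x‖ <
              B₄ * ε₁ * ((F.L : ℝ)⁻¹) ^ (3 * (K - n))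

/-- **LOCATED GAP G-K1a-3a′ AS A SCHEMA — FIRST-ORDER REGULARITY OF THE ONE-STEP (0.4)-AVERAGE** (hypothesis, never asserted; NOT PRINTED):
for every configuration `U` on the finest lattice of run `K+1` whose plaquette variables are within `a` of `1` (`0 ≤ a ≤ c`) and whose
plaquette fields have all backward covariant derivatives `≤ b` (`0 ≤ b`), every backward covariant derivative of every plaquette field of
the one-step average `D_{K,K+1}U` is `≤ C₁b + C₂a²` (zeroth-order twin = the tree's `BlockAveragingPlaquetteBound.plaqSmall_blockAvg_expMeanLogSU`;
at linear order a coarse covariant difference of the averaged curvature telescopes into `L` fine covariant differences of `L²`-sums of fine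
curvatures, `C₁ ≍ L³`; nonlinear corrections quadratic in the deviation over a block, `C₂ ≍ L⁴`).  A statement about the averaging operation ALONE;
in kind: the linearisation of the average [Balaban1985Averaging] (122)/(134). [cite: Balaban1985Averaging, Prop. 3 (122)-(123) p.36] -/
def AvgCurvGradAt (L : ℕ) (C₁ C₂ c : ℝ) : Prop :=
  ∀ F : T3Family, F.L = L → ∀ (K : ℕ) (a b : ℝ), 0 ≤ a → a ≤ c → 0 ≤ b →
    ∀ U : GaugeField (F.P (K + 1)) 0 (Matrix.specialUnitaryGroup (Fin 2) ℂ), PlaqSmall a U →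
      (∀ (x : Site (F.P (K + 1)) 0) (ν κ κ' : Fin (F.P (K + 1)).d), κ ≠ κ' →
        ‖covDerivT 1 (unitsField (toUField U)) ν (plaqFT (unitsField (toUField U)) κ κ') x‖ ≤ b) →
        ∀ (x : Site (F.P K) 0) (ν κ κ' : Fin (F.P K).d), κ ≠ κ' →
          ‖covDerivT 1 (unitsField (toUField (descendTo F ℰp K (K + 1) (Nat.le_succ K) U))) ν
              (plaqFT (unitsField (toUField (descendTo F ℰp K (K + 1) (Nat.le_succ K) U))) κ κ') x‖ ≤ C₁ * b + C₂ * a ^ 2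

/-- **`MinimisersIn8At` IS MONOTONE IN `B₃`** (a larger `B₃` shrinks the window `B₃ε₁ ≤ ε₀` and enlarges the target (8)): print's `B₃` may be
normalised upward. [cite: Balaban1985Variational, Prop 8 p.304] -/
theorem minimisersIn8At_mono {L : ℕ} {a₀ a₁ a₁' B₃ B₃' : ℝ} (ha : a₁' ≤ a₁) (hB : B₃ ≤ B₃')
    (h8 : MinimisersIn8At L a₀ a₁ B₃) : MinimisersIn8At L a₀ a₁' B₃' :=
  fun F hF n K hnK ε₁ ε₀ hε₁ hε₁a hlo hhi V hV U hU hmin =>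
    regFibrePr_mono F (mul_le_mul_of_nonneg_right hB hε₁.le) V
      (h8 F hF n K hnK ε₁ ε₀ hε₁ (hε₁a.trans ha) ((mul_le_mul_of_nonneg_right hB hε₁.le).trans hlo) hhi V hV U hU hmin)

/-- **`MinimiserCurvGradAt` IS MONOTONE IN `B₃`** (only the window shrinks) and antitone in `a₁`. [cite: Balaban1985Variational, Thm 1 (9)-(10) p.279] -/
theorem minimiserCurvGradAt_mono {L : ℕ} {a₀ a₁ a₁' B₃ B₃' B₄ : ℝ} (ha : a₁' ≤ a₁) (hB : B₃ ≤ B₃')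
    (hg : MinimiserCurvGradAt L a₀ a₁ B₃ B₄) : MinimiserCurvGradAt L a₀ a₁' B₃' B₄ :=
  fun F hF n K hnK ε₁ ε₀ hε₁ hε₁a hlo hhi V hV U hU hmin =>
    hg F hF n K hnK ε₁ ε₀ hε₁ (hε₁a.trans ha) ((mul_le_mul_of_nonneg_right hB hε₁.le).trans hlo) hhi V hV U hU hmin

end Schemas

/-! ## §3 The composition: G-K1a-3a ⇐ Thm 1 (9)–(10) ∧ G-K1a-3a′, PROVED -/

section Split

/-- `L^{−3(K+1−n)} = L^{−3}L^{−3(K−n)}` and `L^{−4(K+1−n)} ≤ L^{−3}L^{−3(K−n)}`, `n ≤ K` (bookkeeping). [cite: Balaban1985Variational, (2) p.278] -/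
theorem scale_succ_bounds (F : T3Family) {n K : ℕ} (hnK : n ≤ K) :
    ((F.L : ℝ)⁻¹) ^ (3 * (K + 1 - n)) = ((F.L : ℝ)⁻¹) ^ 3 * ((F.L : ℝ)⁻¹) ^ (3 * (K - n)) ∧
      (((F.L : ℝ)⁻¹) ^ (2 * (K + 1 - n))) ^ 2 ≤ ((F.L : ℝ)⁻¹) ^ 3 * ((F.L : ℝ)⁻¹) ^ (3 * (K - n)) := by
  obtain ⟨ht, ht1⟩ := scale_pos_le_one F (K - n + 1)
  refine ⟨by rw [← pow_add]; congr 1; omega, ?_⟩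
  rw [← pow_mul, ← pow_add, show 2 * (K + 1 - n) * 2 = (3 + 3 * (K - n)) + (K - n + 1) by omega, pow_add]
  exact mul_le_of_le_one_right (pow_pos (inv_pos.mpr (L_cast_pos F)) _).le ht1

/-- **G-K1a-3a ⇐ [Balaban1985Variational] THM 1 (9)–(10) ∧ G-K1a-3a′** (PROVED).  Given the gauge-invariant top-scale reading of (9)–(10) for
minimisers over (6) (`MinimiserCurvGradAt L a₀ a₁ B₃ B₄`) and the first-order regularity of the one-step (0.4)-average (`AvgCurvGradAt L C₁ C₂ c`)
with `B₃, C₂ > 0`, `B₄ ≥ 0` and the normalisation `4C₁B₄ ≤ L³B₃` of print's `B₃`: `AvgDivSmallAt L a₀ a₁′ B₃` with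
`a₁′ = min {a₁, c/B₃, L³/(8C₂B₃)}`.  For a minimiser `U′ ∈ (8)_{K+1}` over (6)_{K+1}(ε₀): plaquettes `< a = B₃ε₁L^{−2(K+1−n)}`, curvature
derivatives `< b = B₄ε₁L^{−3(K+1−n)}`, so the average has curvature derivatives `≤ C₁b + C₂a²`, divergence `≤ 2(C₁b + C₂a²) ≤
2L^{−3}(C₁B₄ε₁ + C₂B₃²ε₁²)L^{−3(K−n)} ≤ ¾B₃ε₁L^{−3(K−n)} < ε₀L^{−3(K−n)}`. [cite: Balaban1985Variational, Thm 1 (8)-(10) p.279] -/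
theorem avgDivSmallAt_of_split {L : ℕ} {a₀ a₁ B₃ B₄ C₁ C₂ c : ℝ} (hB₃ : 0 < B₃) (hB₄ : 0 ≤ B₄) (hC₂ : 0 < C₂)
    (hgrad : MinimiserCurvGradAt L a₀ a₁ B₃ B₄) (havg : AvgCurvGradAt L C₁ C₂ c) (hdom : 4 * (C₁ * B₄) ≤ (L : ℝ) ^ 3 * B₃) :
    AvgDivSmallAt L a₀ (min a₁ (min (c / B₃) ((L : ℝ) ^ 3 / (8 * C₂ * B₃)))) B₃ := by
  intro F hF n K hnK ε₁ ε₀ hε₁ hε₁a hlo hhi V hV U' hU'8 hmin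
  have hε₁a₁ : ε₁ ≤ a₁ := hε₁a.trans (min_le_left _ _)
  have hε₁c : ε₁ ≤ c / B₃ := hε₁a.trans ((min_le_right _ _).trans (min_le_left _ _))
  have hε₁L : ε₁ ≤ (L : ℝ) ^ 3 / (8 * C₂ * B₃) := hε₁a.trans ((min_le_right _ _).trans (min_le_right _ _))
  have hL : (0 : ℝ) < F.L := L_cast_pos F
  have hL' : (0 : ℝ) < (L : ℝ) := by rw [← hF]; exact hL
  have hnK' : n < K + 1 := hnK.trans (Nat.lt_succ_self K)
  -- the minimiser lies in (6)_{K+1}(ε₀) ((8) ⊆ (6)) and its curvature derivatives are `< b`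
  have hU'6 : U' ∈ regFibrePr F n (K + 1) hnK'.le ε₀ V := regFibrePr_mono F hlo V hU'8
  set b : ℝ := B₄ * ε₁ * ((F.L : ℝ)⁻¹) ^ (3 * (K + 1 - n)) with hb_def
  have hb0 : 0 ≤ b := by positivity
  have hder : ∀ (x : Site (F.P (K + 1)) 0) (ν κ κ' : Fin (F.P (K + 1)).d), κ ≠ κ' →
      ‖covDerivT 1 (unitsField (toUField U')) ν (plaqFT (unitsField (toUField U')) κ κ') x‖ ≤ b :=
    fun x ν κ κ' hne => (hgrad F hF n (K + 1) hnK' ε₁ ε₀ hε₁ hε₁a₁ hlo hhi V hV U' hU'6 hmin x ν κ κ' hne).le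
  -- its plaquettes are `< a = B₃ε₁L^{−2(K+1−n)} ≤ B₃ε₁ ≤ c`
  set a : ℝ := regThreshold F n (K + 1) (B₃ * ε₁) with ha_def
  obtain ⟨hs, hs1⟩ := scale_pos_le_one F (2 * (K + 1 - n))
  have hBε : 0 < B₃ * ε₁ := mul_pos hB₃ hε₁
  have ha0 : 0 ≤ a := (mul_pos hBε hs).le
  have hac : a ≤ c := by
    have h1 : a ≤ B₃ * ε₁ := mul_le_of_le_one_right hBε.le hs1
    have h2 : B₃ * ε₁ ≤ c := by
      have := mul_le_mul_of_nonneg_left hε₁c hB₃.le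
      rwa [mul_div_cancel₀ _ hB₃.ne'] at this
    exact h1.trans h2
  have hplaq : PlaqSmall a U' := hU'8.1.2
  -- the averaging schema: curvature derivatives of the average `≤ C₁b + C₂a²`
  have hout := havg F hF K a b ha0 hac hb0 U' hplaq hder
  -- the divergence at every bond of run `K`
  intro bd
  have hdiv := norm_covDivT_le_of_covDerivT_le (unitsField (toUField (descendTo F ℰp K (K + 1) (Nat.le_succ K) U')))
    (x := bd.src) (fun ν κ κ' hne => hout bd.src ν κ κ' hne) bd.dir
  rw [d_sub_one_cast] at hdiv
  refine hdiv.trans_lt ?_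
  -- arithmetic: `2(C₁b + C₂a²) < ε₀·L^{−3(K−n)}`
  obtain ⟨hb_eq, ha_le⟩ := scale_succ_bounds F hnK.le
  set t : ℝ := ((F.L : ℝ)⁻¹) ^ (3 * (K - n)) with ht_def
  obtain ⟨ht, _⟩ := scale_pos_le_one F (3 * (K - n))
  have hL3 : ((F.L : ℝ)⁻¹) ^ 3 = ((L : ℝ) ^ 3)⁻¹ := by rw [hF, inv_pow]
  -- `b = B₄ε₁L^{−3}t`, `a² ≤ B₃²ε₁²L^{−3}t`
  have hb : b = B₄ * ε₁ * ((L : ℝ) ^ 3)⁻¹ * t := by rw [hb_def, hb_eq, hL3]; ring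
  have ha2 : a ^ 2 ≤ (B₃ * ε₁) ^ 2 * ((L : ℝ) ^ 3)⁻¹ * t := by
    rw [ha_def]
    unfold regThreshold
    rw [mul_pow, mul_assoc]
    exact mul_le_mul_of_nonneg_left (by rw [← hL3]; exact ha_le) (sq_nonneg _)
  -- `C₁B₄ε₁/L³ ≤ B₃ε₁/4` and `C₂B₃²ε₁²/L³ ≤ B₃ε₁/8`
  have hL3pos : (0 : ℝ) < (L : ℝ) ^ 3 := by positivity
  have h1 : C₁ * (B₄ * ε₁ * ((L : ℝ) ^ 3)⁻¹) ≤ B₃ * ε₁ / 4 := by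
    rw [show C₁ * (B₄ * ε₁ * ((L : ℝ) ^ 3)⁻¹) = (C₁ * B₄) * ε₁ / (L : ℝ) ^ 3 by ring,
      div_le_iff₀ hL3pos]
    nlinarith [hε₁.le]
  have h2 : C₂ * ((B₃ * ε₁) ^ 2 * ((L : ℝ) ^ 3)⁻¹) ≤ B₃ * ε₁ / 8 := by
    have h8 : 0 < 8 * C₂ * B₃ := by positivity
    have hε : 8 * C₂ * B₃ * ε₁ ≤ (L : ℝ) ^ 3 := by
      have := mul_le_mul_of_nonneg_left hε₁L h8.le
      rwa [mul_div_cancel₀ _ h8.ne'] at this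
    rw [show C₂ * ((B₃ * ε₁) ^ 2 * ((L : ℝ) ^ 3)⁻¹) = (C₂ * B₃ * ε₁) * (B₃ * ε₁) / (L : ℝ) ^ 3 by ring,
      div_le_iff₀ hL3pos]
    nlinarith [hBε]
  calc 2 * (C₁ * b + C₂ * a ^ 2)
      ≤ 2 * (C₁ * (B₄ * ε₁ * ((L : ℝ) ^ 3)⁻¹ * t) + C₂ * ((B₃ * ε₁) ^ 2 * ((L : ℝ) ^ 3)⁻¹ * t)) := by
        rw [hb]; gcongr
    _ = 2 * (C₁ * (B₄ * ε₁ * ((L : ℝ) ^ 3)⁻¹) + C₂ * ((B₃ * ε₁) ^ 2 * ((L : ℝ) ^ 3)⁻¹)) * t := by ring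
    _ ≤ 2 * (B₃ * ε₁ / 4 + B₃ * ε₁ / 8) * t := by gcongr
    _ < ε₀ * t := by
        refine mul_lt_mul_of_pos_right ?_ ht
        nlinarith [hBε]

/-- **THE SAME WITHOUT THE NORMALISATION HYPOTHESIS**: with `B₃′ := max B₃ (4C₁B₄/L³)` (so `4C₁B₄ ≤ L³B₃′`; the printed schemas transfer to `B₃′`
by monotonicity), `MinimisersIn8At ∧ MinimiserCurvGradAt` at `B₃` and `AvgCurvGradAt` give `MinimisersIn8At ∧ AvgDivSmallAt` at `B₃′` and the
shrunken `a₁′`. [cite: Balaban1985Variational, Thm 1 (8)-(10) p.279 and Prop 8 p.304] -/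
theorem avgDivSmallAt_of_split_max {L : ℕ} (hL : 1 ≤ L) {a₀ a₁ B₃ B₄ C₁ C₂ c : ℝ} (ha₁ : 0 < a₁) (hB₃ : 0 < B₃) (hB₄ : 0 ≤ B₄)
    (hC₂ : 0 < C₂) (hc : 0 < c) (h8 : MinimisersIn8At L a₀ a₁ B₃) (hgrad : MinimiserCurvGradAt L a₀ a₁ B₃ B₄)
    (havg : AvgCurvGradAt L C₁ C₂ c) :
    ∃ B₃' a₁' : ℝ, B₃ ≤ B₃' ∧ B₃' = max B₃ (4 * (C₁ * B₄) / (L : ℝ) ^ 3) ∧ 0 < a₁' ∧ a₁' ≤ a₁ ∧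
      MinimisersIn8At L a₀ a₁' B₃' ∧ AvgDivSmallAt L a₀ a₁' B₃' := by
  have hL0 : (0 : ℝ) < (L : ℝ) := by exact_mod_cast hL
  have hL3 : (0 : ℝ) < (L : ℝ) ^ 3 := by positivity
  set B₃' : ℝ := max B₃ (4 * (C₁ * B₄) / (L : ℝ) ^ 3) with hB₃'_def
  have hBB : B₃ ≤ B₃' := le_max_left _ _
  have hB₃' : 0 < B₃' := hB₃.trans_le hBB
  have hdom : 4 * (C₁ * B₄) ≤ (L : ℝ) ^ 3 * B₃' := by
    have := le_max_right B₃ (4 * (C₁ * B₄) / (L : ℝ) ^ 3)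
    rw [div_le_iff₀ hL3] at this
    linarith
  refine ⟨B₃', min a₁ (min (c / B₃') ((L : ℝ) ^ 3 / (8 * C₂ * B₃'))), hBB, rfl, lt_min ha₁ (lt_min (by positivity) (by positivity)),
    min_le_left _ _, minimisersIn8At_mono (min_le_left _ _) hBB h8, ?_⟩
  exact avgDivSmallAt_of_split hB₃' hB₄ hC₂ (minimiserCurvGradAt_mono le_rfl hBB hgrad) havg hdom

end Split

/-! ## §4 What the registered `stub_lower` of the layer-4 birth now rests on -/

section StubLower

/-- **LOWER ⇐ PROP 8 ∧ THM 1 (9)–(10) ∧ G-K1a-3a′ → (G-K1a-3b → stub), UNDER THE ROUTE'S PREFIX** — the tree's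
`T3OneStepAveragingPlaquettes.lowerAlongRegPrMinimisersAt_of_split'` fed with §3: the divergence clause of the averaged minimiser is no longer an
input about minimisers but [Balaban1985Variational] (9)–(10) (PRINTED) plus a first-order statement about the (0.4) averaging alone; the radius
constant of (8) is normalised to `B₃′ = max B₃ (4C₁B₄/L³)`. [cite: Balaban1985Variational, Thm 1 (9)-(10) p.279 and Prop 8 p.304] -/
theorem lowerAlongRegPrMinimisersAt_of_split'' {L : ℕ} (hL : 1 ≤ L) {a₀ a₁ B₃ B₄ C₁ C₂ c : ℝ} (ha₀ : 0 < a₀) (ha₁ : 0 < a₁)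
    (hB₃ : 0 < B₃) (hB₄ : 0 ≤ B₄) (hC₂ : 0 < C₂) (hc : 0 < c) (h8 : MinimisersIn8At L a₀ a₁ B₃)
    (hgrad : MinimiserCurvGradAt L a₀ a₁ B₃ B₄) (havg : AvgCurvGradAt L C₁ C₂ c) :
    ∃ ε₁' : ℝ, 0 < ε₁' ∧ ∀ ε₀ : ℝ, 0 < ε₀ → ε₀ ≤ ε₁' → ∀ m : ℕ, 2 ≤ m → ∀ b₀ p₀ : ℝ, 0 < b₀ →
      ∃ γ₁ : ℝ, 0 < γ₁ ∧ ∀ (F : T3Family) (γ : ℝ), F.L = L → 0 < γ → γ ≤ γ₁ →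
        AvgActionIneqAt F γ b₀ p₀ m ε₀ (max B₃ (4 * (C₁ * B₄) / (L : ℝ) ^ 3)) → LowerAlongRegPrMinimisersAt F γ b₀ p₀ m ε₀ := by
  obtain ⟨B₃', a₁', hBB, hB₃'eq, ha₁', -, h8', hdiv'⟩ := avgDivSmallAt_of_split_max hL ha₁ hB₃ hB₄ hC₂ hc h8 hgrad havg
  rw [← hB₃'eq]
  exact lowerAlongRegPrMinimisersAt_of_split' ha₀ ha₁' (hB₃.trans_le hBB) h8' hdiv'

/-- **THE BODY OF THE REGISTERED `stub_lower` (layer-4 birth v2 of stmt-QuantumFields-19200, for one `L ≥ 1`) FROM PRINT + G-K1a-3a′ + G-K1a-3b**: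
`MinimisersIn8At` ([Balaban1985Variational] Prop 8, PRINTED) ∧ `MinimiserCurvGradAt` (Thm 1 (9)–(10), PRINTED) ∧ `AvgCurvGradAt` (located
G-K1a-3a′, averaging only) ∧ the prefix-form `AvgActionIneqAt` at the normalised radius constant `B₃′ = max B₃ (4C₁B₄/L³)` (located G-K1a-3b) ⇒
`∃ a₀ a₁ B₃ > 0, MinimisersIn8At ∧ AvgDivSmallAt ∧ (prefix) AvgActionIneqAt` verbatim as registered.
[cite: Balaban1985Variational, Thm 1 (8)-(10) p.279 and Prop 8 p.304] -/
theorem stub_lower_shape_of_split {L : ℕ} (hL : 1 ≤ L) {a₀ a₁ B₃ B₄ C₁ C₂ c : ℝ} (ha₀ : 0 < a₀) (ha₁ : 0 < a₁) (hB₃ : 0 < B₃)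
    (hB₄ : 0 ≤ B₄) (hC₂ : 0 < C₂) (hc : 0 < c) (h8 : MinimisersIn8At L a₀ a₁ B₃)
    (hgrad : MinimiserCurvGradAt L a₀ a₁ B₃ B₄) (havg : AvgCurvGradAt L C₁ C₂ c)
    (hineq : ∃ ε₁ : ℝ, 0 < ε₁ ∧ ∀ (ε₀ : ℝ), 0 < ε₀ → ε₀ ≤ ε₁ → ∃ m₀ : ℕ, ∀ (m : ℕ), m₀ ≤ m → ∀ (b₀ p₀ : ℝ), 0 < b₀ → 2 < p₀ →
        ∃ γ₁ : ℝ, 0 < γ₁ ∧ ∀ (F : T3Family) (γ : ℝ), F.L = L → 0 < γ → γ ≤ γ₁ →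
          AvgActionIneqAt F γ b₀ p₀ m ε₀ (max B₃ (4 * (C₁ * B₄) / (L : ℝ) ^ 3))) :
    ∃ a₀ a₁ B₃ : ℝ, 0 < a₀ ∧ 0 < a₁ ∧ 0 < B₃ ∧
      MinimisersIn8At L a₀ a₁ B₃ ∧ AvgDivSmallAt L a₀ a₁ B₃ ∧
      ∃ ε₁ : ℝ, 0 < ε₁ ∧ ∀ (ε₀ : ℝ), 0 < ε₀ → ε₀ ≤ ε₁ → ∃ m₀ : ℕ, ∀ (m : ℕ), m₀ ≤ m → ∀ (b₀ p₀ : ℝ), 0 < b₀ → 2 < p₀ →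
        ∃ γ₁ : ℝ, 0 < γ₁ ∧ ∀ (F : T3Family) (γ : ℝ), F.L = L → 0 < γ → γ ≤ γ₁ →
          AvgActionIneqAt F γ b₀ p₀ m ε₀ B₃ := by
  obtain ⟨B₃', a₁', hBB, hB₃'eq, ha₁', -, h8', hdiv'⟩ := avgDivSmallAt_of_split_max hL ha₁ hB₃ hB₄ hC₂ hc h8 hgrad havg
  refine ⟨a₀, a₁', B₃', ha₀, ha₁', hB₃.trans_le hBB, h8', hdiv', ?_⟩
  rw [hB₃'eq]
  exact hineq

end StubLower

end Literature.MathematicalPhysics.QuantumFieldTheory.Balaban1983to89.T3AvgDivergenceSplit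

end
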